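import Summits.BirchSwinnertonDyer.BirchSwinnertonDyer.Theorems.ThetaPartnerAtTwoSignedKatoUpToAtTwoHondaLogCharSums

/-!
# sidea k2 g24 — stub_cmLambdaLower (RSL_g, item 22608 via crux 26074), family 1 (literature transfer, typed dictionary)

TRIGGER AUDIT after the pen's texts of record (`KZgHold.lean` 464388a381f0bcfe, `KZgHoldGlue.lean` e410cd96665c3584).
Typed content (Mathlib-only, vocabulary-free, 0 sorry / instance / notation):

* `valShape_of_katoShape_of_birch` — the CONVENTION DICTIONARY behind child A's clause (VALρ):
  Kato, Astérisque 295, Thm. 12.5 (1) (p. 221) has the character on the LEFT, `Σ_σ χ(σ) σ(·) per_f(·)^± = c · L_{(p)}(f*, χ, 1)/…`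
  with `± = (−1)^{k−r−1} χ(−1)` (so `+` for even `χ`, `k = 2`, `r = 1`) and `f* = g` for a newform on `Γ₀(M)` with real
  Hecke field; Birch's formula (tree `Literature…ModularSymbols.twisted_LValue_eq`, MTT §I.8 (8.6)) reads
  `τ(χ) · L(g, χ⁻¹, 1)/Ω⁺ = Σ_a χ(a) [a/m]⁺`. Composing the two at `χ := ψ⁻¹` gives exactly the pen's shape
  «`(Σ_b ψ⁻¹(b) τ_b w) · G(ψ) = q · Σ_a ψ(a) [a/2^{m+2}]⁺`» with ONE constant `q = c` for every even `ψ` — typed below over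
  abstract value functionals `V` (Kato side), `Lval` (L-values over the period), `S` (twisted symbol sums), `τ` (Gauss sums).
* `not_forall_even_valShape_of_gaussSum_eq_zero` — the STATEMENT-LEVEL GUARD for the typer of child A (cite item after split GO):
  the binder `ψ.IsPrimitive` in (VALρ) is load-bearing for TRUTH, not only for provability: at an even character with vanishing
  Gauss sum (every imprimitive even `ψ` mod `2^{m+2}`: Mathlib `gaussSum_eq_zero_of_isPrimitive_of_not_isPrimitive`, tree
  `ThetaPartnerAtTwoSignedKatoUpToAtTwoHondaLogCharSums` ll. 140, 165) the left side is `0` while `q · S ψ` is generically nonzero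
  (trivial `ψ`: `(Euler factor) · L(g,1)/Ω⁺`), so «(VALρ) for all even `ψ`» is refutable; the levels `4, 8` are served by the
  separate clause (TRIVρ) (Kato 12.5 (1) at `χ = 1`, depleted Euler factor `3/2` at `a₂ = 0`).

No BSD statement, no crux and no stub is proved here; this is dictionary bookkeeping for the literature lane.
-/

namespace Summit.BirchSwinnertonDyer.BirchSwinnertonDyer.Cruxes.ResidualThetaCountLowerPureAtTwo.SideaK2G24

open DirichletCharacter

variable {R : Type*} [CommRing R] {N : ℕ} [NeZero N]

/-- The inverse of an even Dirichlet character is even. -/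
theorem even_inv {ψ : DirichletCharacter R N} (h : ψ.Even) : ψ⁻¹.Even := by
  unfold DirichletCharacter.Even at h ⊢
  rw [MulChar.inv_apply_eq_inv, h, Ring.inverse_one]

/-- CONVENTION DICTIONARY (Kato 12.5 (1) ∘ Birch ⟹ the (VALρ) shape, one constant).
`V χ` := the Kato-side twisted sum `Σ_b χ(b) τ_b w` (character on the left, as in Kato Thm. 12.5 (1) with `f* = g`);
`Lval χ` := `L(g, χ, 1)/Ω⁺` pushed into `R`; `S χ` := `Σ_a χ(a) [a/N]⁺_g`; `τ χ` := the Gauss sum of `χ`.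
Kato: `V χ = c · Lval χ` for even `χ`; Birch (`twisted_LValue_eq` shape): `τ χ · Lval χ⁻¹ = S χ` for primitive `χ`.
Conclusion: the pen's (VALρ) shape `V ψ⁻¹ · τ ψ = c · S ψ` at every even primitive `ψ`, with the SAME `c`. -/
theorem valShape_of_katoShape_of_birch (V Lval S τ : DirichletCharacter R N → R) (c : R)
    (hK : ∀ χ : DirichletCharacter R N, χ.Even → V χ = c * Lval χ)
    (hB : ∀ χ : DirichletCharacter R N, χ.IsPrimitive → τ χ * Lval χ⁻¹ = S χ)
    (ψ : DirichletCharacter R N) (hψ : ψ.Even) (hprim : ψ.IsPrimitive) :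
    V ψ⁻¹ * τ ψ = c * S ψ := by
  rw [hK ψ⁻¹ (even_inv hψ), ← hB ψ hprim]
  ring

/-- STATEMENT-LEVEL GUARD. If some even character `ψ₀` has vanishing Gauss sum `τ ψ₀ = 0` (every imprimitive even character
of `2`-power level) while `c · S ψ₀ ≠ 0`, then the (VALρ) shape CANNOT hold at all even characters: the primitivity binder of
child A is load-bearing for truth. -/
theorem not_forall_even_valShape_of_gaussSum_eq_zero (V S τ : DirichletCharacter R N → R) (c : R)
    (ψ₀ : DirichletCharacter R N) (h₀ : ψ₀.Even) (hτ : τ ψ₀ = 0) (hS : c * S ψ₀ ≠ 0) :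
    ¬ ∀ ψ : DirichletCharacter R N, ψ.Even → V ψ⁻¹ * τ ψ = c * S ψ := by
  intro h
  have h1 := h ψ₀ h₀
  rw [hτ, mul_zero] at h1
  exact hS h1.symm

/-- The guard INSTANTIATED at `2`-power level with the tree's Ramanujan-sum vanishing (TP2/K3 lineage,
`HondaLogChi.gaussSum_one_zmodChar_eq_zero`, Washington Lemma 4.8): at level `2^M`, `M ≥ 1`, with `ζ^{2^M} = 1 ≠ ζ²`, the trivial
character is even and `∑_{a unit} ζ^a = 0`; so if `c · S 1 ≠ 0` (for (VALρ): `q · μt(0) · Σ_a ι[a/2^M]⁺ ≠ 0`, i.e. the depleted value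
`(3/2)·q·t₀·ι[0]⁺_g` of (TRIVρ) is nonzero) the ∀-even version of the (VALρ) shape is FALSE — child A must keep `ψ.IsPrimitive` and the
separate clause (TRIVρ). -/
theorem not_forall_even_valShape_twoPow [IsDomain R] {M : ℕ} (hM : 1 ≤ M) {ζ : R} (hζM : ζ ^ 2 ^ M = 1) (hζ1 : ζ ^ 2 ≠ 1)
    (V S : DirichletCharacter R (2 ^ M) → R) (c : R) (hS : c * S 1 ≠ 0) :
    ¬ ∀ ψ : DirichletCharacter R (2 ^ M), ψ.Even → V ψ⁻¹ * gaussSum ψ (AddChar.zmodChar (2 ^ M) hζM) = c * S ψ :=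
  haveI : NeZero (2 ^ M) := ⟨pow_ne_zero _ two_ne_zero⟩
  not_forall_even_valShape_of_gaussSum_eq_zero V S (fun ψ ↦ gaussSum ψ (AddChar.zmodChar (2 ^ M) hζM)) c 1
    (by unfold DirichletCharacter.Even; exact MulChar.one_apply (by simp))
    (Summit.BirchSwinnertonDyer.BirchSwinnertonDyer.Theorems.SignedKatoOffTwo.HondaLogChi.gaussSum_one_zmodChar_eq_zero
      (p := 2) hM hζM hζ1) hS

end Summit.BirchSwinnertonDyer.BirchSwinnertonDyer.Cruxes.ResidualThetaCountLowerPureAtTwo.SideaK2G24
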